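import Literature.AlgebraicGeometry.Frobenioids.MonoidTransport
import Literature.AlgebraicGeometry.Frobenioids.RlfStructure
import Literature.AnabelianGeometry.EtaleTheta.FrdIVocabulary
import Literature.AnabelianGeometry.EtaleTheta.Discharge.Sec4Prop42SubRootLawModel

/-!
# [EtTh] Prop 4.2 (iii): the torsion-freeness input `hTF` of the root-law reduction (G-w4d044-3) DISCHARGED at
# the canonical [FrdI] vocabulary `treeMonoidVocab`

Mochizuki, *The étale theta function …*, Publ. RIMS **45** (2009), §3 Def 3.6 (i) PDF p.76 («`Φ₀^ℝ := Φ₀^rlf`»);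
[FrdI] Def 2.4 (i) kurims p.48 (the realification `M^rlf`, an `ℝ_{≥0}`-module) [cite: MochizukiEtTh2009, Def 3.6 p.76].
abc-iut cell, layer L2, plan/GAP-LEDGER.md G-w4d044-3 / D-G-w4d044-3 (p432007 `Sec4Prop42SubRootLawModel.lean`:
`hR ⇐ hR₀ + Φ perfect + hTF`, with `hTF` = injectivity of `N`-th powers in `(Φ^{ℝ-log})^gp` recorded as «a law at
an ABSTRACT vocabulary `V`»).  Seat abc-iut-w4-d044 (gen 3).  PROOF-ONLY (0 `def`s).

At the CANONICAL vocabulary `V := treeMonoidVocab` (`FrdIVocabulary.lean`: `IsRealification := IsRealificationVia`,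
i.e. `Φ₀^ℝ(Y) ≃* (Φ₀(Y))^rlf` is abc-iut-L1's realification `IsPerfFactorial.Rlf`), `hTF` is a THEOREM:
`M^rlf` is perfect (`IsPerfFactorial.Rlf.isPerfect`, [FrdI] Def 2.4 (i)), perfectness transports along the
isomorphism (`IsPerfect.of_mulEquiv`) and passes to the groupification (`isPerfect_grothendieckGroup`), whose
`N`-th power maps are therefore injective (`RealifiedDivisorMonoids.pow_injective_ΦR_gp_treeVocab`; the perfectness of `Φ₀^ℝ(Y)` itself is
also abc-iut's landed `RealifiedDivisorMonoids.isPerfect_ΦR` of `Discharge/Sec3Example39PerfSaturationSubfunctor.lean` — cited, not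
restated as a declaration; its module's olean is unavailable at filing time, so the two-line argument is inlined).  Hence
`Prop42Sub.prop42_iii_iv_mkOfModelCanonical_of_baseRootLaw_treeVocab`: at the canonical model over the canonical
vocabulary, [EtTh] Prop 4.2 (iii) ∧ (iv) ⇐ {`Φ` divisorial, `hDSpull`, `hR₀` (B₀^Λ-level root law, ERRATUM E2),
`hE`, `hS`, `hL`} — the root law for `B` reduced to the one for `B₀^Λ` with NO further input.
HONEST FRAMING: refereed pre-IUT material; nothing here bears on [IUTchIII] Cor. 3.12.
-/

noncomputable section

namespace Literature.AnabelianGeometry.EtaleTheta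

open CategoryTheory Opposite Literature.AlgebraicGeometry.Frobenioids

universe u₀ v₀ u v w

namespace RealifiedDivisorMonoids

variable {D₀ : Type u₀} [Category.{v₀} D₀] (T : RealifiedDivisorMonoids (D₀ := D₀) treeMonoidVocab.{w})

/-- **`hTF` at the canonical vocabulary**: the `N`-th power maps (`N ≥ 1`) of `(Φ₀^ℝ(Y))^gp` are injective (the
groupification of the perfect monoid `Φ₀^ℝ(Y)` is perfect, `isPerfect_grothendieckGroup`). [cite: MochizukiFrdI2008, Def. 2.4(i) p.48] -/
theorem pow_injective_ΦR_gp_treeVocab (Y : D₀ᵒᵖ) {N : ℕ} (hN : 0 < N) :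
    Function.Injective fun x : Algebra.GrothendieckGroup (T.ΦR.obj Y) => x ^ N :=
  -- `Φ₀^ℝ(Y) ≃* (Φ₀(Y))^rlf` is perfect (cf. the landed `RealifiedDivisorMonoids.isPerfect_ΦR` of
  -- `Discharge/Sec3Example39PerfSaturationSubfunctor.lean`, same two-line argument, not importable here while its
  -- olean is missing), hence so is its groupification.
  have hP : IsPerfect (T.ΦR.obj Y) := by
    obtain ⟨h, e, -⟩ := (T.isRealification Y : IsRealificationVia _ _ _)
    exact (IsPerfFactorial.Rlf.isPerfect h).of_mulEquiv e.symm
  ((isPerfect_grothendieckGroup hP).bijective_pow N hN).1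

end RealifiedDivisorMonoids

namespace BiKummerSetting

section Canonical

variable {K : Type u₀} [Field K] (X : SemiGraphs.TemperedArithmeticGroup.{u₀} K) {D₀ : Type u₀}
  [Category.{v₀} D₀] {T : RealifiedDivisorMonoids (D₀ := D₀) treeMonoidVocab.{w}}
  {D : Type u} [Category.{v} D] {VD : FrdICatStub.{u, v, w} D}
  (tf : TemperedFrobenioid T D VD) (hZ : tf.monoidType = MonoidType.Z)
  (hP : ∀ A : Dᵒᵖ, IsPerfect (tf.Φ.carrier A)) (IG : D → Prop) (gS : ∀ A : D, IG A → (X.Pi →* Aut A))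
  (gSs : ∀ (A : D) (h : IG A), Function.Surjective (gS A h))
  (NH : Subgroup (Field.absoluteGaloisGroup K) → tf.category → ℕ+ → Prop) (A₀ : tf.category)
  (hA₀ : PreFrobenioid.IsFrobeniusTrivial tf.toElem A₀) (hA₀' : IG A₀.base)

/-- **[EtTh] Prop 4.2 (iii) ∧ (iv) AS TYPED at the canonical model OVER THE CANONICAL [FrdI] VOCABULARY, the root
law for `B` (G-w4d044-3) reduced to the one for `B₀^Λ` with no further input** ⇐ {`Φ` divisorial, `hDSpull`,
`hR₀` (ERRATUM E2 at `B₀^Λ`), `hE` (G-w4d044-2), `hS` (Def 4.1 (ii)), `hL` (G-w4d044-1)}: p432007's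
`prop42_iii_iv_mkOfModelCanonical_of_baseRootLaw` with `hTF := T.pow_injective_ΦR_gp_treeVocab`.
[cite: MochizukiEtTh2009, Prop 4.2 p.88] -/
theorem Prop42Sub.prop42_iii_iv_mkOfModelCanonical_of_baseRootLaw_treeVocab
    (hΦd : Objectwise (fun M _ => IsDivisorial M) tf.divisorMonoid)
    (hDSpull : ∀ {A A' : D} (e : A' ⟶ A) {a b : tf.Φ.carrier (op A)},
      (∀ x : tf.Φ.carrier (op A), x ∣ a → x ∣ b → x = 1) →
        ∀ y : tf.Φ.carrier (op A'), y ∣ pull tf.divisorMonoid e a → y ∣ pull tf.divisorMonoid e b → y = 1)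
    (hR₀ : ∀ (N : ℕ+) (A : D), IG A → ∀ b : T.BΛ.obj (op (tf.base.obj A)),
      ∃ (A' : D) (_ : IG A') (c : A' ⟶ A) (b' : T.BΛ.obj (op (tf.base.obj A'))),
        b' ^ (N : ℕ) = (T.BΛ.map (tf.base.map c).op).hom b)
    (hE : ∀ (N : ℕ+) (A' : tf.category), PreFrobenioid.IsFrobeniusTrivial tf.toElem A' → IG A'.base →
      ∃ (A'' : tf.category) (ψ : A'' ⟶ A'), PreFrobenioid.IsPullbackMorphism tf.toElem ψ ∧ IG A''.base ∧
        tf.IsMuSaturated A'' N ∧ NH (mkOfModelCanonical X tf hZ hP IG gS gSs NH A₀ hA₀ hA₀').HodotBsFld A'' N)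
    (hS : ∀ ⦃A B : D⦄ (hA : IG A) (hB : IG B) (b : B ⟶ A),
      ∃ c : X.Pi, ∀ g : X.Pi, (gS B hB g).hom ≫ b = b ≫ (gS A hA (c * g * c⁻¹)).hom)
    (hL : ∀ (A'' : tf.category) (N : ℕ+) (g : A''.base ⟶ A₀.base)
      (ξ : tf.ratFnFunctor.obj (op A₀.base)),
      PreFrobenioid.IsFrobeniusTrivial tf.toElem A'' →
      NH (mkOfModelCanonical X tf hZ hP IG gS gSs NH A₀ hA₀ hA₀').HodotBsFld A'' N →
      divB tf.divisorMonoid tf.ratFnFunctor tf.divBNatTrans (op A₀.base) ξ = 1 →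
        ∃ ζ : tf.ratFnFunctor.obj (op A''.base), ζ ^ (N : ℕ) = pull tf.ratFnFunctor g ξ) :
    (mkOfModelCanonical X tf hZ hP IG gS gSs NH A₀ hA₀ hA₀').Prop42_iii (fun {_ _} φ x => tf.pullFracModel φ x) ∧
      (mkOfModelCanonical X tf hZ hP IG gS gSs NH A₀ hA₀ hA₀').Prop42_iv (fun φ x => tf.pullFracModel φ x) :=
  Prop42Sub.prop42_iii_iv_mkOfModelCanonical_of_baseRootLaw X tf hZ hP IG gS gSs NH A₀ hA₀ hA₀' hΦd hDSpull
    (fun A _ hN => T.pow_injective_ΦR_gp_treeVocab (op (tf.base.obj A)) hN) hR₀ hE hS hL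

end Canonical

end BiKummerSetting

end Literature.AnabelianGeometry.EtaleTheta

end
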